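import Summits.ResolutionOfSingularities.ResolutionOfSingularities.Theorems.WeightedInvariantIota3RatioLetterExact
import Summits.ResolutionOfSingularities.ResolutionOfSingularities.Theorems.WeightedInvariantIota3SigmaExtDimTwo
import HarnessLib

/-!
# (CURVE-RATIO) PROVED: at an Abramovich–Quek–Schober lex-max plane germ `(y, x; r, q; rν)` of a two-dimensional regular local ring the
# scaled ratio letter is EXACT, `ν!·r ≤ σ₁(f)·q` (door `HypersurfaceCentreConstruction`, stmt-ResolutionOfSingularities-19897)

Helper for `stub_keyRungGrHomLE_three` (def-free, `--supports 19897`): the TRANSVERSAL half of the `σ`-comparison (SIGMA) of this hand's gap list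
(…KeyRungThreeOfDropCurveSigma / …Iota3CurveSigmaRatioBounds), i.e. hypothesis (CURVE-RATIO) of `keyRungGrHomLE_three_of_tieDescent_point_ratioBounds`.

* **`Iota3.prod_pow_mem_weightedMonomialIdeal_of_mem_weights`**, **`Iota3.weightedMonomialIdeal_le_of_forall_mem`** — monomial ideals are monotone in the generating family: if every `xᵢ ∈ 𝒥_u,w(vᵢ)` then
  `𝒥_{x,v}(n) ≤ 𝒥_{u,w}(n)` (merging / reordering generators).
* **`Iota3.ratioScale_mul_le_sigmaRatioNat_mul_dim2`** — dimension-TWO exactness of the ratio letter: for a BOUNDED witness set, every one-flag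
  reach of slope `r₁/r₂ ≥ 1` gives `ν!·r₁ ≤ σ₁(f)·r₂` (small denominators dominate, `RatContact.exists_ceilDiv_eq_of_denom_le`, as in the
  dimension-three `ratioScale_mul_le_sigmaRatioNat_mul`; the two-flag is recovered by `flagReaches_of_oneFlagReaches_dim2`).
* **`Iota3.mul_le_mul_of_flagReaches_of_isLexMax`** — at a lex-max germ `(yx; (r, q); rν)` of `(f)` every admissible reached triple
  `(q'; r₁, r₂)` has `r₁·q ≤ r·r₂` (one-flag collapse, a complementary parameter, frame independence
  `RatContact.weightedMonomialIdeal_eq_ratContactFiltration`, and the lex-max clause); hence **`bddAbove_ratioSet_of_isLexMax`**.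
* **`Iota3.oneFlagReaches_of_isLexMax`** — the first member `y` reaches `r/q`.
* **`Iota3.ratioScale_mul_le_sigmaRatioNat_mul_of_isLexMax`** — **(CURVE-RATIO)**: `ν!·r ≤ σ₁(f)·q`.

[OURS · L1 W4.3 · kernel lemmas; AI work, weaker than expert review; nothing here is a statement of the manuscript under review
(Hironaka 2017, [claim: Hironaka2017, status: under-review]).]

## References

* D. Abramovich, M. H. Quek, B. Schober, arXiv:2507.01232 (2025), Thm 3.5 (lex-maximal weighted centre germs of plane curves). [AbramovichQuekSchober2025]
* H. Hironaka, *Characteristic polyhedra of singularities*, J. Math. Kyoto Univ. 7 (1967), §3. [Hironaka1967]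
-/

noncomputable section

set_option linter.dupNamespace false -- mandated namespace of this single-conjunct summit

open IsLocalRing Literature.AlgebraicGeometry.Resolution
open Summit.ResolutionOfSingularities.ResolutionOfSingularities.Theorems
open Summit.ResolutionOfSingularities.ResolutionOfSingularities.Cruxes.HypersurfaceCentreConstruction.LocalEngine.Iota3.RatContact

namespace Summit.ResolutionOfSingularities.ResolutionOfSingularities.Cruxes.HypersurfaceCentreConstruction.LocalEngine

namespace Iota3

/-! ## §1 Merging generators of monomial ideals -/

/-- Weighted products with ARBITRARY weights on the factors: if `xᵢ ∈ 𝒥_{u,w}(vᵢ)` for all `i` then `∏ xᵢ^{αᵢ} ∈ 𝒥_{u,w}(Σ vᵢ αᵢ)`.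
[folklore] -/
theorem prod_pow_mem_weightedMonomialIdeal_of_mem_weights {A : Type} [CommRing A] {m m' : ℕ} (u : Fin m' → A) (w : Fin m' → ℕ)
    {x : Fin m → A} {v : Fin m → ℕ} (hx : ∀ i, x i ∈ weightedMonomialIdeal u w (v i)) (α : Fin m → ℕ) :
    ∏ i, x i ^ α i ∈ weightedMonomialIdeal u w (∑ i, v i * α i) := by
  classical
  induction (Finset.univ : Finset (Fin m)) using Finset.induction_on with
  | empty => rw [Finset.prod_empty, Finset.sum_empty, weightedMonomialIdeal_zero]; exact Submodule.mem_top
  | insert i s hi ih =>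
    rw [Finset.prod_insert hi, Finset.sum_insert hi]
    exact weightedMonomialIdeal_mul_le u w _ _ (Ideal.mul_mem_mul (pow_mem_weightedMonomialIdeal u w (hx i) (α i)) ih)

/-- **Monomial ideals are monotone in the generating family**: if every `xᵢ` lies in `𝒥_{u,w}(vᵢ)` then `𝒥_{x,v}(n) ≤ 𝒥_{u,w}(n)` for all `n`.
[folklore] -/
theorem weightedMonomialIdeal_le_of_forall_mem {A : Type} [CommRing A] {m m' : ℕ} (x : Fin m → A) (v : Fin m → ℕ) (u : Fin m' → A)
    (w : Fin m' → ℕ) (hx : ∀ i, x i ∈ weightedMonomialIdeal u w (v i)) (n : ℕ) :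
    weightedMonomialIdeal x v n ≤ weightedMonomialIdeal u w n := by
  have key : ∀ α : Fin m → ℕ, n ≤ ∑ i, v i * α i → ∏ i, x i ^ α i ∈ weightedMonomialIdeal u w n := fun α hα =>
    weightedMonomialIdeal_antitone u w hα (prod_pow_mem_weightedMonomialIdeal_of_mem_weights u w hx α)
  unfold weightedMonomialIdeal
  refine Ideal.span_le.mpr ?_
  rintro _ ⟨α, hα, rfl⟩
  exact key α hα

/-! ## §2 Dimension-two exactness of the ratio letter -/

section DimTwo

variable {A : Type} [CommRing A] [IsRegularLocalRing A]

/-- **The ratio letter is exact in dimension two (bounded witness set)**: for `f ∈ 𝔪 ∖ 0` of a two-dimensional regular local ring whose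
scaled-ratio witness set is bounded, every one-flag reach of slope `r₁/r₂ ≥ 1` has `ν!·r₁ ≤ σ₁(f)·r₂`. [OURS · L1 W4.3 · (R6) at dim 2] -/
theorem ratioScale_mul_le_sigmaRatioNat_mul_dim2 (hdim : ringKrullDim A = (2 : ℕ)) {f : A} (hf0 : f ≠ 0) (hf : f ∈ maximalIdeal A)
    (hbdd : BddAbove {m : ℕ | ∃ q r₁ r₂ : ℕ, AdmissibleTriple q r₁ r₂ ∧ FlagReaches f (adicOrder f).toNat q r₁ r₂ ∧
      m * r₂ ≤ ratioScale (adicOrder f).toNat * r₁})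
    {r₁ r₂ : ℕ} (hr₂ : 0 < r₂) (hr : r₂ ≤ r₁) (hreach : OneFlagReaches f (adicOrder f).toNat r₁ r₂) :
    ratioScale (adicOrder f).toNat * r₁ ≤ sigmaRatioNat f * r₂ := by
  obtain ⟨hν, -, -⟩ := EssSmoothLevels.adicOrder_toNat_spec hf0 hf
  obtain ⟨a', b', hb', hb'ν, hab, hceil⟩ := exists_ceilDiv_eq_of_denom_le (a := r₁) (b := r₂) (ν := (adicOrder f).toNat) hr₂ hν
  obtain ⟨g₁, hg₁, hg₁2, hmem⟩ := hreach
  have hmem' : f ∈ ratContactFiltration g₁ a' b' (a' * (adicOrder f).toNat) := by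
    rw [ratContactFiltration_level_eq_of_ceilDiv_eq g₁ hceil]; exact hmem
  have hb'a' : b' ≤ a' := by
    have h1 : r₂ * b' ≤ a' * r₂ := (Nat.mul_le_mul_right _ hr).trans hab
    rw [mul_comm a' r₂] at h1
    exact Nat.le_of_mul_le_mul_left h1 hr₂
  have hreach' : FlagReaches f (adicOrder f).toNat b' a' b' :=
    flagReaches_of_oneFlagReaches_dim2 hdim ⟨hb', le_rfl, hb'a'⟩ ⟨g₁, hg₁, hg₁2, hmem'⟩
  have hdvd : b' ∣ ratioScale (adicOrder f).toNat := by unfold ratioScale; exact Nat.dvd_factorial hb' hb'ν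
  have hmW : ratioScale (adicOrder f).toNat / b' * a' ∈ {m : ℕ | ∃ q r₁ r₂ : ℕ, AdmissibleTriple q r₁ r₂ ∧
      FlagReaches f (adicOrder f).toNat q r₁ r₂ ∧ m * r₂ ≤ ratioScale (adicOrder f).toNat * r₁} := by
    refine ⟨b', a', b', ⟨hb', le_rfl, hb'a'⟩, hreach', le_of_eq ?_⟩
    calc ratioScale (adicOrder f).toNat / b' * a' * b' = ratioScale (adicOrder f).toNat / b' * b' * a' := by ring
      _ = ratioScale (adicOrder f).toNat * a' := by rw [Nat.div_mul_cancel hdvd]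
  have hmle : ratioScale (adicOrder f).toNat / b' * a' ≤ sigmaRatioNat f := by
    unfold sigmaRatioNat; exact le_csSup hbdd hmW
  have h1 : ratioScale (adicOrder f).toNat * r₁ * b' ≤ ratioScale (adicOrder f).toNat / b' * a' * r₂ * b' :=
    calc ratioScale (adicOrder f).toNat * r₁ * b' = ratioScale (adicOrder f).toNat * (r₁ * b') := by ring
      _ ≤ ratioScale (adicOrder f).toNat * (a' * r₂) := Nat.mul_le_mul_left _ hab
      _ = ratioScale (adicOrder f).toNat / b' * b' * a' * r₂ := by rw [Nat.div_mul_cancel hdvd]; ring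
      _ = ratioScale (adicOrder f).toNat / b' * a' * r₂ * b' := by ring
  exact (Nat.le_of_mul_le_mul_right h1 hb').trans (Nat.mul_le_mul_right _ hmle)

/-! ## §3 Lex-maximality bounds every reached slope -/

/-- **At a lex-max germ every admissible reached triple has slope `≤ r/q`**: `IsLexMaxWeightedCentreGerm A (f) yx (r, q) (rν)` (`A` regular
local of Krull dimension two, `ν ≥ 1`) and `FlagReaches f ν q' r₁ r₂` with `(q'; r₁, r₂)` admissible give `r₁·q ≤ r·r₂`.
[OURS · L1 W4.3] [cite: AbramovichQuekSchober2025, Thm 3.5] -/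
theorem mul_le_mul_of_flagReaches_of_isLexMax (hdim : ringKrullDim A = (2 : ℕ)) {f : A} {yx : Fin 2 → A} {r q ν : ℕ} (hν : 0 < ν)
    (hlex : IsLexMaxWeightedCentreGerm A (Ideal.span {f}) yx ![r, q] (r * ν))
    {q' r₁ r₂ : ℕ} (hadm : AdmissibleTriple q' r₁ r₂) (hreach : FlagReaches f ν q' r₁ r₂) : r₁ * q ≤ r * r₂ := by
  classical
  obtain ⟨-, -, -, -, -, -, -, hmax, -⟩ := hlex
  obtain ⟨-, hr₂, hr₁⟩ := hadm.pos
  obtain ⟨g, hg, hg2, hmem⟩ := FlagReaches.oneFlagReaches hadm hreach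
  have hd2 := spanFinrank_eq_two_of_ringKrullDim hdim
  obtain ⟨z, hz, hz0⟩ := exists_rsop_apply_eq hd2 hg hg2 (0 : Fin 2)
  have hrange : Set.range z = {g, z 1} := by
    rw [← hz0]
    ext t
    simp only [Set.mem_range, Set.mem_insert_iff, Set.mem_singleton_iff]
    constructor
    · rintro ⟨i, hi⟩
      fin_cases i
      · exact Or.inl hi.symm
      · exact Or.inr hi.symm
    · rintro (h | h)
      · exact ⟨0, h.symm⟩
      · exact ⟨1, h.symm⟩
  have h𝔪3 : Ideal.span {z 1, z 1, g} = maximalIdeal A := by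
    rw [Set.insert_eq_of_mem (Set.mem_insert _ _), Set.pair_comm, ← hrange, hz]
  -- `f ∈ ratContactFiltration g r₁ r₂ (r₁ν) = 𝒥((z₁, z₁, g); (r₂, r₂, r₁)) ≤ 𝒥((g, z₁); (r₁, r₂))`
  have hmem3 : f ∈ weightedMonomialIdeal ![z 1, z 1, g] ![r₂, r₂, r₁] (r₁ * ν) := by
    rw [weightedMonomialIdeal_eq_ratContactFiltration h𝔪3 hr₂ hadm.2.2]; exact hmem
  have hle : weightedMonomialIdeal ![z 1, z 1, g] ![r₂, r₂, r₁] (r₁ * ν) ≤ weightedMonomialIdeal ![g, z 1] ![r₁, r₂] (r₁ * ν) := by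
    refine weightedMonomialIdeal_le_of_forall_mem _ _ _ _ (fun i => ?_) _
    fin_cases i
    · exact self_mem_weightedMonomialIdeal ![g, z 1] ![r₁, r₂] 1
    · exact self_mem_weightedMonomialIdeal ![g, z 1] ![r₁, r₂] 1
    · exact self_mem_weightedMonomialIdeal ![g, z 1] ![r₁, r₂] 0
  have hI : Ideal.span {f} ≤ weightedMonomialIdeal ![g, z 1] ![r₁, r₂] (r₁ * ν) :=
    (Ideal.span_singleton_le_iff_mem _).mpr (hle hmem3)
  have hspan : Ideal.span (Set.range ![g, z 1]) = maximalIdeal A := by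
    rw [Matrix.range_cons, Matrix.range_cons, Matrix.range_empty, Set.union_empty, Set.singleton_union, ← hrange, hz]
  have hw' : ∀ i, 0 < (![r₁, r₂] : Fin 2 → ℕ) i := fun i => by fin_cases i <;> assumption
  have hℓ' : 0 < r₁ * ν := Nat.mul_pos hr₁ hν
  rcases hmax ![g, z 1] ![r₁, r₂] (r₁ * ν) hspan hw' hadm.2.2 hℓ' hI with hlt | ⟨-, hle'⟩
  · simp only [Matrix.cons_val_zero] at hlt
    exact absurd hlt (not_lt.mpr (le_of_eq (by ring)))
  · have h1 : r₁ * ν * q ≤ r * ν * r₂ := by simpa using hle'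
    have h2 : r₁ * q * ν ≤ r * r₂ * ν := by
      calc r₁ * q * ν = r₁ * ν * q := by ring
        _ ≤ r * ν * r₂ := h1
        _ = r * r₂ * ν := by ring
    exact Nat.le_of_mul_le_mul_right h2 hν

/-- **Hence the scaled-ratio witness set of a lex-max germ is bounded** (by `ν!·r`). [OURS · L1 W4.3] -/
theorem bddAbove_ratioSet_of_isLexMax (hdim : ringKrullDim A = (2 : ℕ)) {f : A} {yx : Fin 2 → A} {r q ν : ℕ} (hν : 0 < ν) (hq : 0 < q)
    (hνf : (adicOrder f).toNat = ν) (hlex : IsLexMaxWeightedCentreGerm A (Ideal.span {f}) yx ![r, q] (r * ν)) :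
    BddAbove {m : ℕ | ∃ q' r₁ r₂ : ℕ, AdmissibleTriple q' r₁ r₂ ∧ FlagReaches f (adicOrder f).toNat q' r₁ r₂ ∧
      m * r₂ ≤ ratioScale (adicOrder f).toNat * r₁} := by
  refine ⟨ratioScale ν * r, ?_⟩
  rintro m ⟨q', r₁, r₂, hadm, hreach, hm⟩
  rw [hνf] at hreach hm
  obtain ⟨-, hr₂, -⟩ := hadm.pos
  have hslope := mul_le_mul_of_flagReaches_of_isLexMax hdim hν hlex hadm hreach
  -- `m r₂ q ≤ ν! r₁ q ≤ ν! r r₂`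
  have h1 : m * q * r₂ ≤ ratioScale ν * r * r₂ :=
    calc m * q * r₂ = m * r₂ * q := by ring
      _ ≤ ratioScale ν * r₁ * q := Nat.mul_le_mul_right _ hm
      _ = ratioScale ν * (r₁ * q) := by ring
      _ ≤ ratioScale ν * (r * r₂) := Nat.mul_le_mul_left _ hslope
      _ = ratioScale ν * r * r₂ := by ring
  have h2 : m * q ≤ ratioScale ν * r := Nat.le_of_mul_le_mul_right h1 hr₂
  calc m = m * 1 := (mul_one m).symm
    _ ≤ m * q := Nat.mul_le_mul_left _ hq
    _ ≤ ratioScale ν * r := h2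

/-! ## §4 The first member reaches `r/q`; (CURVE-RATIO) -/

/-- **The first member of a lex-max germ reaches the slope `r/q`**: `OneFlagReaches f ν r q` along `y = yx 0`
(`(f) ≤ 𝒥((y,x);(r,q))(rν) = ratContactFiltration y r q (rν)` by frame independence). [OURS · L1 W4.3] [cite: AbramovichQuekSchober2025, Thm 3.5] -/
theorem oneFlagReaches_of_isLexMax (hdim : ringKrullDim A = (2 : ℕ)) {f : A} {yx : Fin 2 → A} {r q ν : ℕ}
    (hlex : IsLexMaxWeightedCentreGerm A (Ideal.span {f}) yx ![r, q] (r * ν)) : OneFlagReaches f ν r q := by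
  classical
  obtain ⟨hspan, hwpos, -, hqr, -, -, hI, -, -⟩ := hlex
  have hq : 0 < q := by simpa using hwpos 1
  have hqr' : q ≤ r := by simpa using hqr
  have hy : yx 0 ∈ maximalIdeal A := hspan ▸ Ideal.subset_span ⟨0, rfl⟩
  have hy2 : yx 0 ∉ maximalIdeal A ^ 2 := by
    have hli := linearIndependent_toCotangent_of_span_eq_maximalIdeal hdim yx hspan
    intro h2
    exact hli.ne_zero 0 ((Ideal.toCotangent_eq_zero _ _).mpr h2)
  have hrange : Set.range yx = {yx 0, yx 1} := by
    ext t
    simp only [Set.mem_range, Set.mem_insert_iff, Set.mem_singleton_iff]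
    constructor
    · rintro ⟨i, hi⟩
      fin_cases i
      · exact Or.inl hi.symm
      · exact Or.inr hi.symm
    · rintro (h | h)
      · exact ⟨0, h.symm⟩
      · exact ⟨1, h.symm⟩
  have h𝔪3 : Ideal.span {yx 1, yx 1, yx 0} = maximalIdeal A := by
    rw [Set.insert_eq_of_mem (Set.mem_insert _ _), Set.pair_comm, ← hrange, hspan]
  refine ⟨yx 0, hy, hy2, ?_⟩
  rw [← weightedMonomialIdeal_eq_ratContactFiltration h𝔪3 hq hqr']
  have hle : weightedMonomialIdeal yx ![r, q] (r * ν) ≤ weightedMonomialIdeal ![yx 1, yx 1, yx 0] ![q, q, r] (r * ν) := by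
    refine weightedMonomialIdeal_le_of_forall_mem _ _ _ _ (fun i => ?_) _
    fin_cases i
    · exact self_mem_weightedMonomialIdeal ![yx 1, yx 1, yx 0] ![q, q, r] 2
    · exact self_mem_weightedMonomialIdeal ![yx 1, yx 1, yx 0] ![q, q, r] 0
  exact hle ((Ideal.span_singleton_le_iff_mem _).mp hI)

/-- **(CURVE-RATIO) — `ν!·r ≤ σ₁(f)·q` at a lex-max germ** `(yx; (r, q); rν)` of `(f)`, `A` regular local of Krull dimension two,
`f ∈ 𝔪^ν ∖ 𝔪^{ν+1}`, `ν ≥ 1`. [OURS · L1 W4.3 · (CURVE-RATIO)] [cite: AbramovichQuekSchober2025, Thm 3.5] -/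
theorem ratioScale_mul_le_sigmaRatioNat_mul_of_isLexMax (hdim : ringKrullDim A = (2 : ℕ)) {f : A} {yx : Fin 2 → A} {r q ν : ℕ}
    (hν : 0 < ν) (hfν : f ∈ maximalIdeal A ^ ν) (hfν1 : f ∉ maximalIdeal A ^ (ν + 1))
    (hlex : IsLexMaxWeightedCentreGerm A (Ideal.span {f}) yx ![r, q] (r * ν)) :
    ratioScale ν * r ≤ sigmaRatioNat f * q := by
  have hq : 0 < q := by simpa using hlex.2.1 1
  have hqr : q ≤ r := by simpa using hlex.2.2.2.1
  have hf : f ∈ maximalIdeal A := by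
    have h := Ideal.pow_le_pow_right hν hfν
    rwa [pow_one] at h
  have hf0 : f ≠ 0 := fun h0 => hfν1 (h0 ▸ Ideal.zero_mem _)
  have hνf : (adicOrder f).toNat = ν := by
    have h : adicOrder f = (ν : ℕ∞) := le_antisymm ((adicOrder_le_iff f ν).mpr hfν1) ((le_adicOrder_iff f ν).mpr hfν)
    rw [h, ENat.toNat_coe]
  have hbdd := bddAbove_ratioSet_of_isLexMax hdim hν hq hνf hlex
  have hreach : OneFlagReaches f (adicOrder f).toNat r q := by rw [hνf]; exact oneFlagReaches_of_isLexMax hdim hlex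
  have h := ratioScale_mul_le_sigmaRatioNat_mul_dim2 hdim hf0 hf hbdd hq hqr hreach
  rwa [hνf] at h

end DimTwo

end Iota3

end Summit.ResolutionOfSingularities.ResolutionOfSingularities.Cruxes.HypersurfaceCentreConstruction.LocalEngine

end
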